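import Mathlib
import Summits.Ventures.HodgeRepro2.LevelPositivity
import Summits.Ventures.HodgeRepro2.LevelBaseChange
import Summits.Ventures.HodgeRepro2.LiuOscillator
import Summits.Ventures.HodgeRepro2.T6B5Datum

/-!
# T6B5IsoHyp — Tier 6, sub-goal B5: the displayed isomorphism of Liu's Theorem 4.18 and the number field M_μ (the route's M̃_μ)

Two displays, each a `def … : Prop` in the free parameter `𝓛 : LiuAlbaneseDatum K c χEF` (the representation-level
carriers of `T6B5Datum.lean`, the only datum of the cell that carries the representation spaces the first sentence of
Theorem 4.18 is about):
* `Liu2021_Thm4_18_directSum` — the first sentence of Theorem 4.18, the isomorphism of C[G(A_F^∞)]-modules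
  Ω(μ) ⊗_{M_μ} C ≃ ⊕_ε ⊕_χ ω(μ, ε, χ) AS PRINTED (t6-p6's `Hyp.Liu2021_Thm4_18_iso` displays the same sentence over
  p2's numeric datum as the term-wise inequality of invariant dimensions it implies — WEAKER, marked there; that
  display stays the binder of `B3_main`; `T6B5Identity.lean` derives it from this one at the shape);
* `Liu2021_p41_numberField` — «M_μ … is a number ﬁeld» (p. 41 ll. 45–49; the print's M_μ = the value field = the
  route's M̃_μ), consumed by the «in particular» clause of TIER4 Theorem B5.1(iv) and by the derivation of t6-p6's
  display.
Statement lane: definitions and `#check` only. Journal page layer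
`paper:liu2021-fourier-jacobi-cycles-arithmetic-relative-trace-formula` (Y. Liu, Cambridge J. Math. 9 (2021), no. 1,
1–147; `p00NN` = journal page NN, `l.` = layer line).
DICTIONARY (t6-lit card C63 / layer rule F14; verified against the author's arXiv v2 source, TeX ll. 1920 / 1928 /
2219 / 2235): THE PRINT HAS NO TILDE. Print **M_μ** = the subfield of ℂ generated by the values μ^alg(x), «a number
ﬁeld» (p. 41 l. 45) = the route's M̃_μ (TIER4 §B5 Conventions) = the carried `𝓛.Mt μ`; Theorem 4.18's tensor and
Definition 4.16's «acts M_μ-linearly» are over this field. Print **M′_μ** = the reflex field of (E, Φ_μ), Definition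
4.3(2) (p0041 l. 35) = the route's M_μ. The page layer prints every PRIME as the non-printing byte 0x02 (so its «Mμ»
can be either; the readings below say which) and every direct sum ⊕ as the byte 0x03. The route's symbol M̃_μ is
used in the display brackets only, never inside the quotes. The v1 module-docstring claim (p411783) that the layer
«drops tildes» is withdrawn: there was no tilde in print to drop (QA-t6lit-88 nit (a), QA-t6lit-89).
v2 (2026-08-26, gen 5) = p411783 with the docstrings corrected per QA-t6lit-88 / 89; both `def`s are byte-identical to
p411783.
README §8(d): uses an L-value-free non-vanishing device: NO.
-/

namespace Summit.Ventures.HodgeRepro2.T6.Hyp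

open Summit.Ventures.HodgeRepro2.LevelPositivity Summit.Ventures.HodgeRepro2.ShimuraData
  Summit.Ventures.HodgeRepro2.T6.B5Datum
open TensorProduct

universe u

variable {K : Type u} [Field K] [NumberField K] [NumberField.IsCMField K] {c : Liu.IdeleConjugation K}
  {χEF : Liu.QuadraticCharacter K c}

/-- [cite: Liu2021, Theorem 4.18 (first sentence), Cambridge J. Math. 9 (2021) p. 52 ll. 37–47, layer
paper:liu2021-fourier-jacobi-cycles-arithmetic-relative-trace-formula p0052 ll. 37–47; the standing μ of Definition
4.16, p0052 ll. 6–9] «Theorem 4.18. There is an isomorphism» ‹Ω(μ) ⊗_{Mμ} C ≃ ⊕_ε ⊕_χ ω(μ, ε, χ)› (the display, layer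
ll. 39–44 exploded in reading order: «Ω(μ) ⊗Mμ C ≃» l. 39, «ω(μ, ε, χ)» l. 40, «ε» l. 41, «χ» l. 43; the two direct-sum
signs are non-printing glyphs of the layer) «of C[G(A∞
F )]-modules, where the direct sum is taken over all ε, χ such that
ε is μ-admissible.» (layer ll. 45–47; «A∞F» = A_F^∞ with the layer's displaced sub/superscript; «Mμ» = the print's
M_μ, the value field of p. 41 = the route's M̃_μ — no tilde in print, module docstring DICTIONARY) — μ «a conjugate
symplectic character of weight one» (Definition 4.16, p0052 ll. 6–8) [display: over B5's representation-level datum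
𝓛: for every conjugate symplectic weight-one `μ` (`Liu.IsWeightOneConjugateSymplectic`), a `ℂ`-linear equivalence
`e : ℂ ⊗[M̃_μ] Ω(μ) ≃ ⨁_r W_r` (route symbols: M̃_μ = the print's M_μ = `𝓛.Mt μ`) commuting with the actions of
`G(A_F^∞)` — the base change `baseChangeRep (𝓛.ρΩ μ)` (the `ℂ[G]`-module Ω(μ) ⊗_{M_μ} ℂ, `G` acting through the first
factor, Definition 4.16 ‹G(A_F^∞) acts M_μ-linearly›, layer p0052 ll. 11–15 exploded «acts via iμ and G(A∞» / «)» /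
«acts» / «M» / «-linearly» — the μ subscript lost by the layer, no tilde; author's source TeX l. 2219 «acts
$M_\mu$-linearly») against Mathlib's `Representation.directSum` of the carried representations `𝓛.ω r` — indexed by
the CLASSES `r = 𝓛.osc t` of the admissible triples `t = (μ, ε, χ)` with first component `μ` («all ε, χ such that ε is
μ-admissible» = `Liu.OscillatorTriple.IsAdmissible K t`, t6-p6's reading), each class once (Thm. 4.18(2): the summands
are mutually non-isomorphic — the reading under which t6-p6's d(μ, K) = `Liu.liuMultiplicity` is the printed sum);
‹isomorphism of C[G(A_F^∞)]-modules› (a restored paraphrase of «of C[G(A∞ / F )]-modules», ll. 42–43) = `ℂ`-linear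
equivalence + `G`-equivariance. FAITHFUL in the carried vocabulary; the standing assumption on μ is kept as the
hypothesis] [quote-audit: QA-t6lit-88 (t6-lit register, 2026-08-25T23:33:07Z, card C63 (b)): EXACT 9/9 + EXACT-ALNUM
1 («A∞F» for the layer's split «A∞» / «F )») on the layer quotes, the reading ‹Ω(μ) ⊗_{Mμ} C ≃ ⊕_ε ⊕_χ ω(μ, ε, χ)›
= TeX l. 2235; its nits (a) (the tilde the print does not have) and (b) (the restored paraphrase marked ‹…›) applied
in this docstring-only revision; the `def` is byte-identical to p411783] -/
def Liu2021_Thm4_18_directSum (𝓛 : LiuAlbaneseDatum K c χEF) : Prop :=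
  ∀ μ : Liu.AutomorphicCharacter K, Liu.IsWeightOneConjugateSymplectic K c χEF μ →
    ∃ e : (ℂ ⊗[𝓛.Mt μ] 𝓛.Omega μ) ≃ₗ[ℂ]
        DirectSum {r : 𝓛.Rep // ∃ t : Liu.OscillatorTriple K c χEF,
          t.μ = μ ∧ Liu.OscillatorTriple.IsAdmissible K t ∧ 𝓛.osc t = r} (fun r => 𝓛.W r.1),
      ∀ (g : 𝓛.G) (v : ℂ ⊗[𝓛.Mt μ] 𝓛.Omega μ),
        e (baseChangeRep (𝓛.ρΩ μ) g v) = Representation.directSum (fun r => 𝓛.ω r.1) g (e v)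

/-- [cite: Liu2021, §4.1, the paragraph defining μ^alg and the value field M_μ (the route's M̃_μ), between Definition
4.3 (p0041 ll. 32–36) and Remark 4.4 (l. 50 ff.), Cambridge J. Math. 9 (2021) p. 41 ll. 37–49, layer
paper:liu2021-fourier-jacobi-cycles-arithmetic-relative-trace-formula p0041 ll. 37–49] «Now let μ be a conjugate
symplectic automorphic character, which is
not algebraic. We put» ‹μ^alg := μ · | |_E^{−1/2},› (the display, layer ll. 39–43 exploded: «−1/2» l. 39, «μalg := μ · | |E»
l. 41, «,» l. 43) «which is then algebraic. Denote by Mμ ⊆ C the subﬁeld generated by values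
×

μalg (x) for x ∈ (A∞
E ) , which is a number ﬁeld containing Mμ .» (layer ll. 45–49, quoted with the layer's line breaks: «(A∞_E)^×» with
the displaced «×» on l. 46 and «E )» on l. 49; the empty line inside the quote is l. 47 = the non-printing byte 0x02
alone, the DISPLACED PRIME of the M′_μ of l. 49 (layer rule F14). DICTIONARY: the FIRST «Mμ» (l. 45) is the print's
M_μ, the subfield generated by the values μ^alg(x) = the route's M̃_μ — the object which «is a number ﬁeld», the
displayed clause; the LAST «Mμ» (l. 49) is the print's M′_μ, the reflex field of (E, Φ_μ) of Definition 4.3(2) (p0041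
l. 35 «we denote by Mμ⟨02⟩ ⊆ C the reﬂex ﬁeld of (E, Φμ )») = the route's M_μ; author's source TeX l. 1928 «which is a
number field containing $M'_\mu$», l. 1920 «$M'_\mu\subseteq\dC$ the reflex field of $(E,\Phi_\mu)$». READING:
‹Denote by M_μ ⊆ ℂ the subfield generated by values μ^alg(x) for x ∈ (A_E^∞)^×, which is a number field containing
M′_μ.›) [display: only «is a number ﬁeld» is carried — `FiniteDimensional ℚ (𝓛.Mt μ)` for the carried subfield
`𝓛.Mt μ : IntermediateField ℚ ℂ` (= the route's M̃_μ = the print's M_μ; its definition as the field generated by the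
values of μ^alg and the clause «containing» the reflex field M′_μ (the route's M_μ) are not carried, the datum having
no μ^alg) — for every conjugate symplectic automorphic character `μ` (the standing hypothesis; «not algebraic» holds
for every conjugate symplectic character, Rem. 4.2, and is not restated). WEAKER than print (a consequence of the
printed sentence), marked] [quote-audit: QA-t6lit-89 (t6-lit register, 2026-08-25T23:33:07Z, card C63 (c)): EXACT 9/9
+ EXACT-ALNUM 3 on the layer quotes (the control-byte line l. 47 shown as the empty line, the restorations declared
above); its gloss inversion (v1 named the reflex field «M_μ» and the value field «[M̃]_μ») and its locator nit
(«Definition 4.4» → Remark 4.4) corrected in this docstring-only revision; the `def` is byte-identical to p411783] -/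
def Liu2021_p41_numberField (𝓛 : LiuAlbaneseDatum K c χEF) : Prop :=
  ∀ μ : Liu.AutomorphicCharacter K, Liu.IsConjugateSymplectic K c χEF μ → FiniteDimensional ℚ (𝓛.Mt μ)

#check @Liu2021_Thm4_18_directSum
#check @Liu2021_p41_numberField

end Summit.Ventures.HodgeRepro2.T6.Hyp
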